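import Summits.RiemannHypothesis.RiemannHypothesis.Theses.PrimeTwistCeiling
import HarnessLib

/-!
# `PrimeTwistCeiling.Assembly` (item stmt-RiemannHypothesis-24928) — the RH-free bridge of route PrimeTwistCeiling

`Assembly := PrimeTwistSaving → TwistedTuranLocalisation → Strip.StripZeroFreeStrip`.
Proof: from K1 take η and the threshold T₀(A) for the A of K2(η); from K2(η) take A, T₁. A zero ρ with
Re ρ ≥ 1 − η/2 and |Im ρ| ≥ max(T₀,T₁) would give an x ∈ [|Im ρ|, |Im ρ|^A] where the twisted Chebyshev error is
simultaneously > x^(1−η) (K2) and ≤ x^(1−η) (K1): contradiction. Below height max(T₀,T₁) the zeros with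
0 ≤ Re ρ ≤ 1 form a finite set (Mathlib `IsCompact.inter_riemannZetaZeros_finite`; none has Re ρ ≥ 1 by
`riemannZeta_ne_zero_of_one_le_re`), so their real parts are ≤ θ₀ < 1; δ := min(1 − θ₀, η/2).
Ideator rh-idea-5 g4 (W-02 row «DENSITY CEILING LINE», lens oqh). Pure logic + one Mathlib finiteness fact.
Nothing here bears on the truth of RH. No summit is proved by a line.
-/

set_option linter.dupNamespace false  -- the mandated namespace repeats `RiemannHypothesis`

namespace Summit.RiemannHypothesis.RiemannHypothesis.Theorems.PrimeTwistCeilingAssembly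

open Summit.RiemannHypothesis.RiemannHypothesis.Theses.PrimeTwistCeiling

/-- Below any height the real parts of the zeros of `ζ` stay boundedly below `1`
(Mathlib `IsCompact.inter_riemannZetaZeros_finite` + `riemannZeta_ne_zero_of_one_le_re`). -/
theorem lowZeros_re_le (T : ℝ) :
    ∃ θ : ℝ, θ < 1 ∧ ∀ ρ : ℂ, riemannZeta ρ = 0 → |ρ.im| ≤ T → ρ.re ≤ θ := by
  have hK : IsCompact (Set.Icc (0 : ℝ) 1 ×ℂ Set.Icc (-T) T) :=
    (isCompact_Icc).reProdIm isCompact_Icc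
  have hfin := hK.inter_riemannZetaZeros_finite
  set S := hfin.toFinset with hS
  have hlt : ∀ ρ ∈ S, ρ.re < 1 := by
    intro ρ hρ
    rw [hS, Set.Finite.mem_toFinset] at hρ
    exact lt_of_not_ge fun h ↦ riemannZeta_ne_zero_of_one_le_re h hρ.2
  by_cases hne : S.Nonempty
  · obtain ⟨ρ₀, hρ₀, hmax⟩ := S.exists_max_image (fun ρ : ℂ ↦ ρ.re) hne
    refine ⟨max ρ₀.re 0, max_lt (hlt ρ₀ hρ₀) one_pos, fun ρ hρ him ↦ ?_⟩
    by_cases h0 : 0 ≤ ρ.re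
    · have h1 : ρ.re ≤ 1 := le_of_lt (lt_of_not_ge fun h ↦ riemannZeta_ne_zero_of_one_le_re h hρ)
      have hmem : ρ ∈ S := by
        rw [hS, Set.Finite.mem_toFinset]
        exact ⟨Complex.mem_reProdIm.2 ⟨⟨h0, h1⟩, abs_le.1 him⟩, hρ⟩
      exact (hmax ρ hmem).trans (le_max_left _ _)
    · push Not at h0
      exact h0.le.trans (le_max_right _ _)
  · refine ⟨0, one_pos, fun ρ hρ him ↦ ?_⟩
    by_contra h0
    push Not at h0
    have h1 : ρ.re ≤ 1 := le_of_lt (lt_of_not_ge fun h ↦ riemannZeta_ne_zero_of_one_le_re h hρ)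
    exact hne ⟨ρ, by
      rw [hS, Set.Finite.mem_toFinset]
      exact ⟨Complex.mem_reProdIm.2 ⟨⟨h0.le, h1⟩, abs_le.1 him⟩, hρ⟩⟩

/-- The bridge (= the `Assembly` item): K1 ∧ K2 ⇒ route Strip's crux `StripZeroFreeStrip`. -/
theorem stripZeroFreeStrip_of (h₁ : PrimeTwistSaving) (h₂ : TwistedTuranLocalisation) :
    Summit.RiemannHypothesis.RiemannHypothesis.Theses.Strip.StripZeroFreeStrip := by
  obtain ⟨η, hη, hη1, H1⟩ := h₁
  obtain ⟨A, hA, T₁, hT₁, H2⟩ := h₂ η hη hη1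
  obtain ⟨T₀, hT₀, H1'⟩ := H1 A hA
  obtain ⟨θ₀, hθ₀, H3⟩ := lowZeros_re_le (max T₀ T₁)
  have high : ∀ ρ : ℂ, riemannZeta ρ = 0 → max T₀ T₁ ≤ |ρ.im| → ρ.re < 1 - η / 2 := by
    intro ρ hρ hM
    by_contra hge
    push Not at hge
    obtain ⟨x, hx1, hx2, hlt⟩ := H2 ρ hρ hge (le_trans (le_max_right _ _) hM)
    have hle := H1' ρ.im (le_trans (le_max_left _ _) hM) x hx1 hx2
    exact absurd (lt_of_lt_of_le hlt hle) (lt_irrefl _)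
  refine ⟨min (1 - θ₀) (η / 2), lt_min (by linarith) (by linarith), ?_⟩
  intro s hs hlo _hhi
  by_cases hM : max T₀ T₁ ≤ |s.im|
  · have := high s hs hM
    have : 1 - min (1 - θ₀) (η / 2) ≥ 1 - η / 2 := by
      have := min_le_right (1 - θ₀) (η / 2); linarith
    linarith
  · push Not at hM
    have := H3 s hs hM.le
    have : 1 - min (1 - θ₀) (η / 2) ≥ θ₀ := by
      have := min_le_left (1 - θ₀) (η / 2); linarith
    linarith

/-- **`Assembly` (item stmt-RiemannHypothesis-24928) holds.** [folklore] -/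
theorem assembly_proof : Summit.RiemannHypothesis.RiemannHypothesis.Theses.PrimeTwistCeiling.Assembly :=
  fun h₁ h₂ ↦ stripZeroFreeStrip_of h₁ h₂

end Summit.RiemannHypothesis.RiemannHypothesis.Theorems.PrimeTwistCeilingAssembly
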